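import Literature.Topology.FourManifolds.SliceCartesian2
import HarnessLib

/-!
# Gluing monotone pieces of the slice height, and the height along the push-off under an increasing angle

Topic `Literature/Topology/FourManifolds`; fact seat `provefact-IsStrictHandleSlide.isSurgery`
(R. C. Kirby, *The Topology of 4-Manifolds*, LNM 1374 (1989), Ch. I §4, Fig. 4.2; remaining content:
the named fact (S) `Literature.Topology.FourManifolds.FramedLink.IsStrictHandleSlide.slideModel`).
Two elementary tools for reading the slid circle `K₂` and the finger knot `K₁` in the twisted
meridian chart along the knot parameter. (1) **Local-to-global**: if a function `y` agrees near
every point of `[a, b]` with some function having negative derivative there, then `y` has negative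
derivative on `[a, b]` and is strictly decreasing (`strictAntiOn_of_local_pieces`). (2) **Down the
push-off**: the Cartesian twisted height `s ↦ sliceY c 1 (cos (θ s)) (sin (θ s))` of the point of
the push-off at an angle `θ s` increasing in `s` (`θ' > 0`) has negative derivative wherever the
point lies in the open left half-plane of the twisted chart (`hasDerivAt_sliceY_pushOff`,
`deriv_sliceY_pushOff_neg`; `SliceCartesian2.deriv_sliceY_circle_neg_iff`).

## References

* R. C. Kirby, *The Topology of 4-Manifolds*, LNM 1374, Springer (1989), Ch. I §4. [Kirby1989]
-/

open scoped Topology ContDiff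
open Set Real Filter

noncomputable section

namespace Literature.Topology.FourManifolds

/-- **Local pieces with negative derivative glue to a strictly decreasing function.** If near every
point of `[a, b]` the function `y` coincides with a function differentiable there with negative
derivative, then `deriv y < 0` on `[a, b]` and `y` is strictly decreasing on `[a, b]`. [folklore] -/
theorem strictAntiOn_of_local_pieces {y : ℝ → ℝ} {a b : ℝ}
    (h : ∀ s ∈ Icc a b, ∃ g : ℝ → ℝ, ∃ g' : ℝ, y =ᶠ[𝓝 s] g ∧ HasDerivAt g g' s ∧ g' < 0) :
    (∀ s ∈ Icc a b, HasDerivAt y (deriv y s) s ∧ deriv y s < 0) ∧ StrictAntiOn y (Icc a b) := by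
  have hd : ∀ s ∈ Icc a b, HasDerivAt y (deriv y s) s ∧ deriv y s < 0 := by
    intro s hs
    obtain ⟨g, g', hyg, hg, hneg⟩ := h s hs
    have hy : HasDerivAt y g' s := hg.congr_of_eventuallyEq hyg
    rw [hy.deriv]
    exact ⟨hy, hneg⟩
  refine ⟨hd, ?_⟩
  refine strictAntiOn_of_deriv_neg (convex_Icc _ _) (fun s hs ↦ (hd s hs).1.continuousAt.continuousWithinAt) ?_
  intro s hs
  rw [interior_Icc] at hs
  exact (hd s (Ioo_subset_Icc_self hs)).2

/-- **The height of the push-off point at an increasing angle.** [folklore] -/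
theorem hasDerivAt_sliceY_pushOff (c : ℝ) {θ : ℝ → ℝ} {θ' s : ℝ} (hθ : HasDerivAt θ θ' s) :
    HasDerivAt (fun s ↦ sliceY c 1 (cos (θ s)) (sin (θ s)))
      (1 * (2 * exp (c * 1) * ((1 + exp (c * 1) ^ 2) * cos (θ s) - (exp (c * 1) ^ 2 - 1)) / sliceD c 1 (cos (θ s)) ^ 2) * θ') s :=
  (hasDerivAt_sliceY_circle c 1 (θ s)).comp s hθ

/-- **Down the push-off the height decreases in the left half-plane**: with `θ' > 0` and the point
`(cos θ, sin θ)` of the push-off in the open left half-plane of the twisted chart, the derivative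
of the height along `s` is negative. [cite: Kirby1989, Ch. I §4] -/
theorem deriv_sliceY_pushOff_neg (c : ℝ) {θ : ℝ → ℝ} {θ' s : ℝ} (hθ : HasDerivAt θ θ' s) (hθ' : 0 < θ')
    (hleft : sliceX c 1 (cos (θ s)) (sin (θ s)) < 0) :
    deriv (fun s ↦ sliceY c 1 (cos (θ s)) (sin (θ s))) s < 0 := by
  rw [(hasDerivAt_sliceY_pushOff c hθ).deriv]
  have hcirc : deriv (fun φ ↦ sliceY c 1 (cos φ) (sin φ)) (θ s) < 0 :=
    (deriv_sliceY_circle_neg_iff c one_pos (θ s)).2 hleft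
  rw [(hasDerivAt_sliceY_circle c 1 (θ s)).deriv] at hcirc
  exact mul_neg_of_neg_of_pos hcirc hθ'

/-- **The left half-plane along an arc of the push-off.** If at two angles `θ₁ ≤ θ₂` with
`θ₂ - θ₁ < 2π`... we only need the elementary form: `sliceX c 1 (cos θ) (sin θ) < 0` iff
`(1 + E²) cos θ < E² - 1`, `E = e^{c}`; hence if it holds at `θ₁` and at `θ₂ = 2π - θ₁'` with
`cos` bounded on `[θ₁, θ₂]` by `max (cos θ₁) (cos θ₂)`, it holds in between. We record the
criterion in terms of `cos`. [folklore] -/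
theorem sliceX_pushOff_neg_iff (c θ : ℝ) :
    sliceX c 1 (cos θ) (sin θ) < 0 ↔ (1 + exp c ^ 2) * cos θ < exp c ^ 2 - 1 := by
  rw [sliceX_circle_eq, mul_one, one_mul]
  have hD := sliceD_cos_pos c 1 θ
  constructor
  · intro h
    by_contra hge
    have : 0 ≤ ((1 + exp c ^ 2) * cos θ - (exp c ^ 2 - 1)) / sliceD c 1 (cos θ) :=
      div_nonneg (by linarith [le_of_not_gt hge]) hD.le
    linarith
  · intro h
    exact div_neg_of_neg_of_pos (by linarith) hD

/-- On an arc `[θ₁, θ₂]` of the push-off on which `cos θ ≤ max (cos θ₁) (cos θ₂)` (e.g. any arc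
containing `π` with `θ₂ - θ₁ ≤ 2π`... supplied by the caller), negativity of the twisted abscissa at
the two ends propagates to the whole arc. [folklore] -/
theorem sliceX_pushOff_neg_of_ends (c : ℝ) {θ₁ θ₂ θ : ℝ} (h₁ : sliceX c 1 (cos θ₁) (sin θ₁) < 0)
    (h₂ : sliceX c 1 (cos θ₂) (sin θ₂) < 0) (hcos : cos θ ≤ max (cos θ₁) (cos θ₂)) :
    sliceX c 1 (cos θ) (sin θ) < 0 := by
  rw [sliceX_pushOff_neg_iff] at h₁ h₂ ⊢
  have hE : 0 < 1 + exp c ^ 2 := by positivity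
  rcases le_total (cos θ₁) (cos θ₂) with h | h
  · rw [max_eq_right h] at hcos; nlinarith
  · rw [max_eq_left h] at hcos; nlinarith

/-- **The cosine on an arc through the far point**: for `θ₁ ≤ θ ≤ θ₂` with `θ₁ ≤ π ≤ θ₂`,
`0 ≤ θ₁` and `θ₂ ≤ 2π`, `cos θ ≤ max (cos θ₁) (cos θ₂)` (cosine decreases on `[0, π]` and
increases on `[π, 2π]`). [folklore] -/
theorem cos_le_max_of_mem_arc {θ₁ θ₂ θ : ℝ} (h0 : 0 ≤ θ₁) (h1 : θ₁ ≤ θ) (h2 : θ ≤ θ₂) (h3 : θ₂ ≤ 2 * π) :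
    cos θ ≤ max (cos θ₁) (cos θ₂) := by
  rcases le_total θ π with hθ | hθ
  · -- on `[θ₁, θ] ⊆ [0, π]` cosine decreases
    exact (cos_le_cos_of_nonneg_of_le_pi h0 hθ h1).trans (le_max_left _ _)
  · -- on `[θ, θ₂] ⊆ [π, 2π]`: `cos θ = cos (2π - θ)` with `2π - θ₂ ≤ 2π - θ ≤ π`
    have e1 : cos θ = cos (2 * π - θ) := by rw [cos_two_pi_sub]
    have e2 : cos θ₂ = cos (2 * π - θ₂) := by rw [cos_two_pi_sub]
    rw [e1, e2]
    exact (cos_le_cos_of_nonneg_of_le_pi (by linarith) (by linarith) (by linarith)).trans (le_max_right _ _)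

end Literature.Topology.FourManifolds
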